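import Summits.NavierStokesRegularity.NavierStokesRegularity.Theorems.PalasekTowerBreakdownEpisodeBaseStrainPairingLevelTwo

/-!
# Strain-currency pairing lemmas, Part V: converting the `iteratedFDeriv` majorants of `StrainBudgetOn` into the
# `fderiv ∘ fderiv` majorants used by the level-1/level-2 lemmas

Cell `ns-blowup`, seat `ns-palasek-19179-p2` (g6; `--supports stmt-NavierStokesRegularity-19179`). The strategist line
`Cruxes/EpisodeBase/Lines/straindoor.lean` states the Hessian and third-derivative majorants of the pseudo-run as
`‖iteratedFDeriv ℝ 2 (w t) x‖ ≤ σ₂ t` and `‖iteratedFDeriv ℝ 3 (w t) x‖ ≤ σ₃ t` (fields `StrainBudgetOn.hess`,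
`StrainBudgetOn.third`), while Parts II–IV of this series (`…StrainPairingStretching`, `…StrainPairingLevelTwo`,
`…StrainPairingLevelTwoStretching`) take `‖fderiv ℝ (fderiv ℝ u) x‖ ≤ σ₂` and, per basis direction,
`‖fderiv ℝ (fderiv ℝ (fun y => fderiv ℝ u y (b l))) x‖ ≤ σ₃`. This file supplies the two conversions (Mathlib's
curried/uncurried isometries `norm_iteratedFDeriv_fderiv`, `norm_iteratedFDeriv_one`, and
`ContinuousLinearMap.norm_iteratedFDeriv_comp_left` for the evaluation map at a unit vector), so that the budget's
majorants feed the pairing lemmas verbatim. LABEL: E–C analysis (KERNEL: theorems only; no definition, no named fact,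
no `sorry`; register-free). WHAT THIS IS NOT: not Navier–Stokes evidence — norm bookkeeping for derivatives; nothing
about any flow, design or blow-up.

* `norm_fderiv_fderiv_eq_norm_iteratedFDeriv_two` — `‖D(Du)(x)‖ = ‖D²u(x)‖` (`iteratedFDeriv ℝ 2`).
* `norm_fderiv_fderiv_le_of_iteratedFDeriv_two_le` — `‖D²u‖ ≤ σ₂ ⇒ ‖D(Du)(x)‖ ≤ σ₂`.
* `norm_fderiv_fderiv_fderiv_apply_le_iteratedFDeriv_three` — `‖D(D(∂ₗu))(x)‖ ≤ ‖D³u(x)‖` for the unit vector `bₗ`.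
* `norm_fderiv_fderiv_fderiv_apply_le_of_iteratedFDeriv_three_le` — `‖D³u‖ ≤ σ₃ ⇒ ‖D(D(∂ₗu))(x)‖ ≤ σ₃`.

References: P. Constantin, C. Foias, *Navier–Stokes Equations*, 1988, Ch. 10 [cite: ConstantinFoiasNSE1988, Ch. 10 Thm. 10.2].
-/

noncomputable section

set_option linter.dupNamespace false

open MeasureTheory Filter Function Set
open scoped ENNReal NNReal RealInnerProductSpace Topology
open Literature.Analysis.FunctionSpaces Literature.Analysis.FluidPDE

namespace Summit.NavierStokesRegularity.NavierStokesRegularity.Theorems.StrainPairing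

variable {E : Type*} [NormedAddCommGroup E] [InnerProductSpace ℝ E] [FiniteDimensional ℝ E]
variable {E' : Type*} [NormedAddCommGroup E'] [InnerProductSpace ℝ E']

omit [FiniteDimensional ℝ E] in
/-- `‖D(Du)(x)‖ = ‖iteratedFDeriv ℝ 2 u x‖` (the curried and uncurried second derivatives are isometric).
[cite: ConstantinFoiasNSE1988, Ch. 10 Thm. 10.2] -/
theorem norm_fderiv_fderiv_eq_norm_iteratedFDeriv_two (u : E → E') (x : E) :
    ‖fderiv ℝ (fderiv ℝ u) x‖ = ‖iteratedFDeriv ℝ 2 u x‖ := by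
  rw [← norm_iteratedFDeriv_one (𝕜 := ℝ) (f := fderiv ℝ u), norm_iteratedFDeriv_fderiv]

omit [FiniteDimensional ℝ E] in
/-- A Hessian majorant in `iteratedFDeriv` form gives the `fderiv ∘ fderiv` majorant of Parts II–IV.
[cite: ConstantinFoiasNSE1988, Ch. 10 Thm. 10.2] -/
theorem norm_fderiv_fderiv_le_of_iteratedFDeriv_two_le {u : E → E'} {σ₂ : ℝ}
    (h : ∀ x, ‖iteratedFDeriv ℝ 2 u x‖ ≤ σ₂) (x : E) : ‖fderiv ℝ (fderiv ℝ u) x‖ ≤ σ₂ := by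
  rw [norm_fderiv_fderiv_eq_norm_iteratedFDeriv_two]; exact h x

/-- `‖D(D(∂ₗu))(x)‖ ≤ ‖iteratedFDeriv ℝ 3 u x‖` for the unit basis vector `bₗ` (`∂ₗu = (evaluation at bₗ) ∘ Du`, a
continuous linear map of norm `≤ ‖bₗ‖ = 1` after the second derivative). [cite: ConstantinFoiasNSE1988, Ch. 10 Thm. 10.2] -/
theorem norm_fderiv_fderiv_fderiv_apply_le_iteratedFDeriv_three {u : E → E'} (hu : ContDiff ℝ 3 u) (x : E)
    (l : Fin (Module.finrank ℝ E)) :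
    ‖fderiv ℝ (fderiv ℝ (fun y => fderiv ℝ u y (stdOrthonormalBasis ℝ E l))) x‖ ≤ ‖iteratedFDeriv ℝ 3 u x‖ := by
  set b := stdOrthonormalBasis ℝ E with hb
  set L : (E →L[ℝ] E') →L[ℝ] E' := ContinuousLinearMap.apply ℝ E' (b l) with hL
  have hrep : (fun y => fderiv ℝ u y (b l)) = L ∘ fderiv ℝ u := by
    funext y; simp [hL]
  rw [norm_fderiv_fderiv_eq_norm_iteratedFDeriv_two, hrep]
  have hd : ContDiff ℝ 2 (fderiv ℝ u) := hu.fderiv_right (m := 2) (by norm_cast)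
  have h1 : ‖iteratedFDeriv ℝ 2 (L ∘ fderiv ℝ u) x‖ ≤ ‖L‖ * ‖iteratedFDeriv ℝ 2 (fderiv ℝ u) x‖ :=
    L.norm_iteratedFDeriv_comp_left hd.contDiffAt le_rfl
  have hLn : ‖L‖ ≤ 1 := by
    refine ContinuousLinearMap.opNorm_le_bound _ zero_le_one fun T => ?_
    rw [hL, ContinuousLinearMap.apply_apply, one_mul]
    exact (T.le_opNorm _).trans (by rw [b.orthonormal.1 l, mul_one])
  calc ‖iteratedFDeriv ℝ 2 (L ∘ fderiv ℝ u) x‖ ≤ ‖L‖ * ‖iteratedFDeriv ℝ 2 (fderiv ℝ u) x‖ := h1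
    _ ≤ 1 * ‖iteratedFDeriv ℝ 2 (fderiv ℝ u) x‖ := by gcongr
    _ = ‖iteratedFDeriv ℝ 3 u x‖ := by rw [one_mul, norm_iteratedFDeriv_fderiv]

/-- A third-derivative majorant in `iteratedFDeriv` form gives the per-direction majorant of Part IV.
[cite: ConstantinFoiasNSE1988, Ch. 10 Thm. 10.2] -/
theorem norm_fderiv_fderiv_fderiv_apply_le_of_iteratedFDeriv_three_le {u : E → E'} (hu : ContDiff ℝ 3 u)
    {σ₃ : ℝ} (h : ∀ x, ‖iteratedFDeriv ℝ 3 u x‖ ≤ σ₃) (l : Fin (Module.finrank ℝ E)) (x : E) :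
    ‖fderiv ℝ (fderiv ℝ (fun y => fderiv ℝ u y (stdOrthonormalBasis ℝ E l))) x‖ ≤ σ₃ :=
  (norm_fderiv_fderiv_fderiv_apply_le_iteratedFDeriv_three hu x l).trans (h x)

end Summit.NavierStokesRegularity.NavierStokesRegularity.Theorems.StrainPairing

end
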